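import Summits.AtomisticToContinuum.BoseEinsteinCondensation.Theorems.BECInsertionCorrectorCorrectorClosureNearMinimiserRigidityFrame
import HarnessLib

/-!
# Near-minimiser rigidity on the torus, III: the stub `stub_nearMinimiserRigidity`
# (line `healing-scale-kac-insertion`, crux `BECInsertionCorrector.CorrectorClosure`,
# item stmt-AtomisticToContinuum-12058)

Part 3 of 3. Fixed `N` and `L > 0`, BOUNDED periodised potential, continuous positive Feynman–Kac ground
states `Θ₀` (`N` bodies) and `Φ₀` (`N+1` bodies) GIVEN. The stub moves the ground-state insertion residue
`A = L⁻³(∫Θ₀ ∫_cell Φ₀)²` into the crux's near-minimiser frame: for every `ε > 0` there are `δ > 0` and a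
`δ`-near-minimiser `Θ` of the `N`-body energy such that every `δ`-near-minimiser `Ψ` of the `(N+1)`-body
energy has `A ≤ Res(Θ,Ψ) + ε`, `Res(Θ,Ψ) = L⁻³|∫ conj Θ ∫_cell Ψ|²`. It is the only place the line uses
the energy WINDOW on `Ψ`; `δ` is produced after `N` (an `N`-uniform window is false,
`Negative/InsertionResidueUniformWindowFalse`).

Proof: `rigidity_of_nearMinimiser` (Part II) for both problems with `η = t²`, `t = min(ε/6, 1/10)`, a
`δ`-near-minimiser `Θ` from `E₀ < ⊤` and the definition of the infimum, then bilinearity and the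
Cauchy–Schwarz bound of the overlap: `√Res ≥ (1-2η)√A - 2t`, whence `A ≤ Res + 6t ≤ Res + ε`
(`sq_le_sq_add_of_lower`, using `A ≤ 1`).
-/

noncomputable section

open MeasureTheory Filter Matrix
open scoped ENNReal NNReal ComplexConjugate InnerProductSpace Topology

namespace Summit.AtomisticToContinuum.BoseEinsteinCondensation.Theorems.CorrectorClosure.HealingScaleKacInsertion

open Literature.MathematicalPhysics.QuantumManyBody.BoseGas

variable {N : ℕ} {L : ℝ}

/-! ### The elementary inequality that converts closeness into the residue bound -/

/-- If `0 ≤ s ≤ 1`, `0 ≤ t ≤ 1/10` and `r ≥ (1 - 2t²)s - 2t`, then `s² ≤ r² + 6t`. [folklore] -/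
theorem sq_le_sq_add_of_lower {s r t : ℝ} (hs0 : 0 ≤ s) (hs1 : s ≤ 1) (ht0 : 0 ≤ t)
    (ht1 : t ≤ 1 / 10) (h : (1 - 2 * t ^ 2) * s - 2 * t ≤ r) : s ^ 2 ≤ r ^ 2 + 6 * t := by
  have h2 : t ^ 2 ≤ t / 10 := by nlinarith
  by_cases hq : (1 - 2 * t ^ 2) * s - 2 * t ≤ 0
  · have h3 : s ≤ 3 * t := by nlinarith
    nlinarith
  · push Not at hq
    have hq' : ((1 - 2 * t ^ 2) * s - 2 * t) ^ 2 ≤ r ^ 2 := pow_le_pow_left₀ hq.le h 2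
    have h4 : s ^ 2 - ((1 - 2 * t ^ 2) * s - 2 * t) ^ 2 =
        (2 * t ^ 2 * s + 2 * t) * (s + ((1 - 2 * t ^ 2) * s - 2 * t)) := by ring
    have h5 : 2 * t ^ 2 * s + 2 * t ≤ 2 * t ^ 2 + 2 * t := by nlinarith
    have h6 : s + ((1 - 2 * t ^ 2) * s - 2 * t) ≤ 2 := by nlinarith
    have h7 : (2 * t ^ 2 * s + 2 * t) * (s + ((1 - 2 * t ^ 2) * s - 2 * t)) ≤ (2 * t ^ 2 + 2 * t) * 2 :=
      mul_le_mul h5 h6 (by linarith) (by positivity)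
    nlinarith

/-- A continuous periodic complex function is bounded. [folklore] -/
theorem exists_norm_le_of_continuous_periodic (hL : 0 < L) {F : Config N → ℂ} (hF : Continuous F)
    (hper : ∀ (X : Config N) (i : Fin N) (k : Fin 3),
      F (X + Pi.single i (EuclideanSpace.single k L)) = F X) : ∃ B, ∀ X, ‖F X‖ ≤ B := by
  obtain ⟨B, -, hB⟩ := exists_bound_of_continuous_periodic hL (continuous_norm.comp hF)
    (fun X i k => by simp only [Function.comp_apply, hper X i k])
  exact ⟨B, fun X => (le_abs_self _).trans (hB X)⟩

/-- The complex overlap of two real functions is the real overlap. [folklore] -/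
theorem overlap_ofReal (L : ℝ) (Θ₀ : Config N → ℝ) (Φ₀ : Config (N + 1) → ℝ) :
    (∫ X in cellN N L, conj ((Θ₀ X : ℂ)) * ∫ x in cell L, ((Φ₀ (vecCons x X) : ℝ) : ℂ)) =
      ((∫ X in cellN N L, Θ₀ X * ∫ x in cell L, Φ₀ (vecCons x X) : ℝ) : ℂ) := by
  rw [← integral_complex_ofReal]
  refine integral_congr_ae (Eventually.of_forall fun X => ?_)
  simp only [integral_complex_ofReal, Complex.conj_ofReal, Complex.ofReal_mul]

/-- The cell mass of the complexification of a Feynman–Kac ground state is one. [folklore] -/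
theorem lintegral_nnnorm_ofReal_sq_eq_one {M : ℕ} {v : ℝ → ℝ≥0∞} {Ψ₀ : Config M → ℝ}
    (hΨ : IsPeriodicGroundStateFK v L Ψ₀) :
    ∫⁻ X in cellN M L, (‖(Ψ₀ X : ℂ)‖₊ : ℝ≥0∞) ^ 2 = 1 := by
  rw [← hΨ.norm_eq]
  refine lintegral_congr fun X => ?_
  rw [nnnorm_coe_sq_eq_ofReal, Complex.norm_real, Real.norm_eq_abs, sq_abs, ENNReal.ofReal_pow (hΨ.nonneg X)]

/-! ### The stub: rigidity moves the ground-state residue into the near-minimiser frame -/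

/-- **Stub 3 of the line `healing-scale-kac-insertion` — rigidity of near-minimisers at fixed `N`
(bounded potentials).** In a box `L > 0` with bounded `v^per`, if `Θ₀` (`N` bodies) and `Φ₀` (`N+1`
bodies) are continuous positive Feynman–Kac ground states, then for every `ε > 0` there are `δ > 0`
(chosen AFTER `N`, below the finite-volume gaps) and a `δ`-near-minimiser `Θ` of the `N`-body energy
such that for EVERY `δ`-near-minimiser `Ψ` of the `(N+1)`-body energy the ground-state residue
`A = L⁻³(∫ Θ₀ ∫_cell Φ₀)²` is at most the overlap `Res(Θ,Ψ) = L⁻³|∫ conj Θ ∫_cell Ψ|²` plus `ε`.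
Proof: `rigidity_of_nearMinimiser` twice (`Θ ≈ αΘ₀`, `Ψ ≈ βΦ₀` in `L²(cell)` up to `η = t²`,
`t = min(ε/6, 1/10)`), bilinearity and the Cauchy–Schwarz bound `|ov(F,G)| ≤ √(L³)‖F‖‖G‖` of the
overlap give `√Res ≥ (1-2η)√A - 2t`, whence `A ≤ Res + 6t ≤ Res + ε` (`A ≤ 1`).
[cite: ReedSimonIV1978, Thm XIII.44] -/
theorem stub_nearMinimiserRigidity (v : ℝ → ℝ≥0∞) (hv : IsRepulsiveFiniteRange v) (N : ℕ) (L : ℝ)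
    (hL : 0 < L) (hb : ∃ C : ℝ≥0, ∀ x, periodizedPotential v L x ≤ C)
    (Θ₀ : Config N → ℝ) (hΘ : IsPeriodicGroundStateFK v L Θ₀) (hΘc : Continuous Θ₀) (hΘp : ∀ X, 0 < Θ₀ X)
    (Φ₀ : Config (N + 1) → ℝ) (hΦ : IsPeriodicGroundStateFK v L Φ₀) (hΦc : Continuous Φ₀)
    (hΦp : ∀ X, 0 < Φ₀ X) (ε : ℝ) (hε : 0 < ε) :
    ∃ δ : ℝ≥0∞, 0 < δ ∧ ∃ Θ : PeriodicTrialState N L,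
      periodicEnergy v Θ ≤ periodicGroundStateEnergy v N L + δ ∧
      ∀ Ψ : PeriodicTrialState (N + 1) L,
        periodicEnergy v Ψ ≤ periodicGroundStateEnergy v (N + 1) L + δ →
        ENNReal.ofReal ((L ^ 3)⁻¹ *
            (∫ X in cellN N L, Θ₀ X * ∫ x in cell L, Φ₀ (vecCons x X)) ^ 2) ≤
          ENNReal.ofReal ((L ^ 3)⁻¹) *
              (‖∫ X in cellN N L, conj (Θ.ψ X) * ∫ x in cell L, Ψ.ψ (vecCons x X)‖₊ : ℝ≥0∞) ^ 2 +
            ENNReal.ofReal ε := by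
  obtain ⟨C, hC⟩ := hb
  have hvm : Measurable v := hv.1
  -- the closeness parameter `η = t²`
  obtain ⟨t, ht⟩ : ∃ t : ℝ, t = min (ε / 6) (1 / 10) := ⟨_, rfl⟩
  have ht0 : 0 < t := by rw [ht]; exact lt_min (by positivity) (by norm_num)
  have htε : 6 * t ≤ ε := by have := min_le_left (ε / 6) (1 / 10); rw [ht]; linarith
  have ht1 : t ≤ 1 / 10 := by rw [ht]; exact min_le_right _ _
  have hη : 0 < t ^ 2 := by positivity
  obtain ⟨δ₁, hδ₁, hrig₁⟩ := rigidity_of_nearMinimiser hvm hL hC hΘ hΘc hΘp hη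
  obtain ⟨δ₂, hδ₂, hrig₂⟩ := rigidity_of_nearMinimiser hvm hL hC hΦ hΦc hΦp hη
  have hδ0 : 0 < min δ₁ δ₂ := lt_min hδ₁ hδ₂
  -- a `δ`-near-minimiser `Θ` of the `N`-body problem
  have hlt : periodicGroundStateEnergy v N L <
      periodicGroundStateEnergy v N L + ENNReal.ofReal (min δ₁ δ₂) :=
    ENNReal.lt_add_right hΘ.energy_ne_top (by rwa [Ne, ENNReal.ofReal_eq_zero, not_le])
  obtain ⟨Θ, hΘE⟩ : ∃ Θ : PeriodicTrialState N L,
      periodicEnergy v Θ < periodicGroundStateEnergy v N L + ENNReal.ofReal (min δ₁ δ₂) := iInf_lt_iff.1 hlt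
  refine ⟨ENNReal.ofReal (min δ₁ δ₂), ENNReal.ofReal_pos.2 hδ0, Θ, hΘE.le, fun Ψ hΨE => ?_⟩
  obtain ⟨α, hα1, hα2, hαΘ⟩ := hrig₁ Θ (hΘE.le.trans (by gcongr; exact min_le_left _ _))
  obtain ⟨β, hβ1, hβ2, hβΨ⟩ := hrig₂ Ψ (hΨE.trans (by gcongr; exact min_le_right _ _))
  -- measurability and bounds
  have hΘm : Measurable Θ.ψ := Θ.contDiff.continuous.measurable
  have hΨm : Measurable Ψ.ψ := Ψ.contDiff.continuous.measurable
  have hΘ₀m : Measurable fun X => (Θ₀ X : ℂ) := Complex.measurable_ofReal.comp hΘ.measurable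
  have hΦ₀m : Measurable fun Z => (Φ₀ Z : ℂ) := Complex.measurable_ofReal.comp hΦ.measurable
  have hF'm : Measurable fun X => α * (Θ₀ X : ℂ) := measurable_const.mul hΘ₀m
  have hG'm : Measurable fun Z => β * (Φ₀ Z : ℂ) := measurable_const.mul hΦ₀m
  have hΘb := exists_norm_le_of_continuous_periodic hL Θ.contDiff.continuous Θ.periodic
  have hΨb := exists_norm_le_of_continuous_periodic hL Ψ.contDiff.continuous Ψ.periodic
  have hF'b : ∃ B, ∀ X, ‖α * (Θ₀ X : ℂ)‖ ≤ B := by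
    obtain ⟨B, -, hB⟩ := exists_bound_of_continuous_periodic hL hΘc hΘ.periodic
    exact ⟨‖α‖ * B, fun X => by rw [norm_mul, Complex.norm_real]; exact mul_le_mul_of_nonneg_left (hB X) (norm_nonneg _)⟩
  have hG'b : ∃ B, ∀ Z, ‖β * (Φ₀ Z : ℂ)‖ ≤ B := by
    obtain ⟨B, -, hB⟩ := exists_bound_of_continuous_periodic hL hΦc hΦ.periodic
    exact ⟨‖β‖ * B, fun Z => by rw [norm_mul, Complex.norm_real]; exact mul_le_mul_of_nonneg_left (hB Z) (norm_nonneg _)⟩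
  -- unit masses
  have hnΘ₀ := lintegral_nnnorm_ofReal_sq_eq_one hΘ
  have hnΦ₀ := lintegral_nnnorm_ofReal_sq_eq_one hΦ
  have hF'n : ∫⁻ X in cellN N L, (‖α * (Θ₀ X : ℂ)‖₊ : ℝ≥0∞) ^ 2 = (‖α‖₊ : ℝ≥0∞) ^ 2 := by
    simp_rw [nnnorm_mul, ENNReal.coe_mul, mul_pow]
    rw [lintegral_const_mul' _ _ (by simp), hnΘ₀, mul_one]
  -- the ground-state overlap `S` and its size
  set S : ℝ := ∫ X in cellN N L, Θ₀ X * ∫ x in cell L, Φ₀ (vecCons x X) with hS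
  have hS0 : 0 ≤ S := integral_nonneg fun X => mul_nonneg (hΘ.nonneg X) (integral_nonneg fun x => hΦ.nonneg _)
  have hovR := overlap_ofReal L Θ₀ Φ₀
  have hl : 0 < Real.sqrt (L ^ 3) := Real.sqrt_pos.2 (by positivity)
  have hSl : S ≤ Real.sqrt (L ^ 3) := by
    have h := norm_overlap_le hL hΘ₀m hΦ₀m (by rw [hnΘ₀]; exact ENNReal.one_ne_top)
      (by rw [hnΦ₀]; exact ENNReal.one_ne_top)
    rw [hovR, hnΘ₀, hnΦ₀, Complex.norm_real, Real.norm_of_nonneg hS0] at h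
    simpa using h
  -- `ov(αΘ₀, βΦ₀) = conj α · β · S`
  have hovFG : (∫ X in cellN N L, conj (α * (Θ₀ X : ℂ)) * ∫ x in cell L, β * (Φ₀ (vecCons x X) : ℂ)) =
      conj α * β * S := by
    have hpt : ∀ X : Config N, conj (α * (Θ₀ X : ℂ)) * ∫ x in cell L, β * (Φ₀ (vecCons x X) : ℂ) =
        (conj α * β) * (conj ((Θ₀ X : ℂ)) * ∫ x in cell L, ((Φ₀ (vecCons x X) : ℝ) : ℂ)) := by
      intro X; rw [integral_const_mul, map_mul]; ring
    simp_rw [hpt]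
    rw [integral_const_mul, hovR]
  -- the two error terms
  have e1 : ‖∫ X in cellN N L, conj (Θ.ψ X - α * (Θ₀ X : ℂ)) * ∫ x in cell L, Ψ.ψ (vecCons x X)‖ ≤
      Real.sqrt (L ^ 3) * t := by
    have hfin : ∫⁻ X in cellN N L, (‖Θ.ψ X - α * (Θ₀ X : ℂ)‖₊ : ℝ≥0∞) ^ 2 ≠ ⊤ :=
      ne_top_of_le_ne_top ENNReal.ofReal_ne_top hαΘ
    have h := norm_overlap_le hL (hΘm.sub hF'm) hΨm hfin (by rw [Ψ.norm_eq]; exact ENNReal.one_ne_top)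
    rw [Ψ.norm_eq, ENNReal.toReal_one, Real.sqrt_one, mul_one] at h
    refine h.trans (mul_le_mul_of_nonneg_left ?_ hl.le)
    rw [← Real.sqrt_sq ht0.le]
    refine Real.sqrt_le_sqrt ?_
    have := ENNReal.toReal_mono ENNReal.ofReal_ne_top hαΘ
    rwa [ENNReal.toReal_ofReal hη.le] at this
  have e2 : ‖∫ X in cellN N L, conj (α * (Θ₀ X : ℂ)) *
      ∫ x in cell L, (Ψ.ψ (vecCons x X) - β * (Φ₀ (vecCons x X) : ℂ))‖ ≤ Real.sqrt (L ^ 3) * t := by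
    have hfin : ∫⁻ Z in cellN (N + 1) L, (‖Ψ.ψ Z - β * (Φ₀ Z : ℂ)‖₊ : ℝ≥0∞) ^ 2 ≠ ⊤ :=
      ne_top_of_le_ne_top ENNReal.ofReal_ne_top hβΨ
    have h := norm_overlap_le hL hF'm (hΨm.sub hG'm)
      (by rw [hF'n]; exact ENNReal.pow_ne_top ENNReal.coe_ne_top) hfin
    rw [hF'n, toReal_coe_nnnorm_sq, Real.sqrt_sq (norm_nonneg _)] at h
    have hη' : Real.sqrt ((∫⁻ Z in cellN (N + 1) L, (‖Ψ.ψ Z - β * (Φ₀ Z : ℂ)‖₊ : ℝ≥0∞) ^ 2).toReal) ≤ t := by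
      rw [← Real.sqrt_sq ht0.le]
      refine Real.sqrt_le_sqrt ?_
      have := ENNReal.toReal_mono ENNReal.ofReal_ne_top hβΨ
      rwa [ENNReal.toReal_ofReal hη.le] at this
    calc _ ≤ Real.sqrt (L ^ 3) * ‖α‖ * Real.sqrt ((∫⁻ Z in cellN (N + 1) L,
          (‖Ψ.ψ Z - β * (Φ₀ Z : ℂ)‖₊ : ℝ≥0∞) ^ 2).toReal) := h
      _ ≤ Real.sqrt (L ^ 3) * 1 * t := by gcongr
      _ = Real.sqrt (L ^ 3) * t := by rw [mul_one]
  -- bilinearity and the triangle inequality: `‖ov(Θ,Ψ)‖ ≥ ‖α‖‖β‖S - 2√(L³)t`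
  have hsub := overlap_sub_overlap L (F := Θ.ψ) (F' := fun X => α * (Θ₀ X : ℂ)) (G := Ψ.ψ)
    (G' := fun Z => β * (Φ₀ Z : ℂ)) hΘm hF'm hΨm hG'm hΘb hF'b hΨb hG'b
  rw [hovFG] at hsub
  have hkey : (1 - 2 * t ^ 2) * S - 2 * (Real.sqrt (L ^ 3) * t) ≤
      ‖∫ X in cellN N L, conj (Θ.ψ X) * ∫ x in cell L, Ψ.ψ (vecCons x X)‖ := by
    have h1 : ‖conj α * β * (S : ℂ)‖ = ‖α‖ * ‖β‖ * S := by
      rw [norm_mul, norm_mul, RCLike.norm_conj, Complex.norm_real, Real.norm_of_nonneg hS0]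
    have h2 : 1 - 2 * t ^ 2 ≤ ‖α‖ * ‖β‖ := by
      nlinarith [hα1, hα2, hβ1, hβ2, norm_nonneg α, norm_nonneg β, mul_nonneg (norm_nonneg α) (norm_nonneg β)]
    have h3 := norm_sub_norm_le (conj α * β * (S : ℂ))
      (∫ X in cellN N L, conj (Θ.ψ X) * ∫ x in cell L, Ψ.ψ (vecCons x X))
    rw [norm_sub_rev, hsub, h1] at h3
    have h4 := (norm_add_le _ _).trans (add_le_add e1 e2)
    have h5 : (1 - 2 * t ^ 2) * S ≤ ‖α‖ * ‖β‖ * S := mul_le_mul_of_nonneg_right h2 hS0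
    linarith
  -- divide by `√(L³)` and conclude in `ℝ`
  have hL3 : 0 < L ^ 3 := by positivity
  have hreal := sq_le_sq_add_of_lower (s := S / Real.sqrt (L ^ 3))
    (r := ‖∫ X in cellN N L, conj (Θ.ψ X) * ∫ x in cell L, Ψ.ψ (vecCons x X)‖ / Real.sqrt (L ^ 3))
    (div_nonneg hS0 hl.le) ((div_le_one hl).2 hSl) ht0.le ht1 (by
      rw [mul_div_assoc', div_sub' hl.ne', div_le_div_iff_of_pos_right hl]
      linarith)
  rw [div_pow, div_pow, Real.sq_sqrt hL3.le] at hreal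
  have hfinal : (L ^ 3)⁻¹ * S ^ 2 ≤
      (L ^ 3)⁻¹ * ‖∫ X in cellN N L, conj (Θ.ψ X) * ∫ x in cell L, Ψ.ψ (vecCons x X)‖ ^ 2 + ε := by
    rw [inv_mul_eq_div, inv_mul_eq_div]
    linarith
  -- back to `[0, ∞]`
  calc ENNReal.ofReal ((L ^ 3)⁻¹ * S ^ 2)
      ≤ ENNReal.ofReal ((L ^ 3)⁻¹ *
          ‖∫ X in cellN N L, conj (Θ.ψ X) * ∫ x in cell L, Ψ.ψ (vecCons x X)‖ ^ 2 + ε) :=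
        ENNReal.ofReal_le_ofReal hfinal
    _ = _ := by
        rw [ENNReal.ofReal_add (by positivity) hε.le, ENNReal.ofReal_mul (by positivity),
          nnnorm_coe_sq_eq_ofReal]

end Summit.AtomisticToContinuum.BoseEinsteinCondensation.Theorems.CorrectorClosure.HealingScaleKacInsertion

end
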